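import Summits.AtomisticToContinuum.HydrodynamicLimit.Theorems.JParityClosureOddContactSymmetryGibbsInvariance
import Mathlib.Analysis.Convex.Integral
import Mathlib.Analysis.SpecialFunctions.Complex.Circle

/-!
# Gibbs tilts for `KineticFluxLdDecay` (1/5): Jensen, Gaussian facts, and the tilt identity

Part 1 of the negative-knowledge series `Theorems/KineticFluxLdDecay/Negative/{TiltBasics, TiltLowerBound,
TiltWitnessCalc, GibbsTilts, GibbsTiltsPhiBound}` for the crux `AntiMazurCoboundaries.KineticFluxLdDecay`
(stmt-AtomisticToContinuum-10967), from the standing disprover's `Cruxes/KineticFluxLdDecay/Disproof.lean` § 3: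
(A) Jensen for `exp` in `lintegral` form and its Donsker–Varadhan (density) form; (B) `E cos⟪w,t⟫ = e^{-‖t‖²/2}`,
`E sin⟪w,t⟫ = 0`, isometry invariance and vanishing of odd integrands under `stdGaussian`; (C) sums of one-body
functions under product laws; (D) the log-likelihood ratio `llr1` of Maxwellians and the GIBBS TILT IDENTITY
`localGibbsMeasure_ref_eq_withDensity`: the reference homogeneous Gibbs measure (`a = θ = 1`, `u = 0`) is the
tilted one (drift `u₁`, temperature `θ₁`) times `e^{∑ᵢ llr1(vᵢ)}` (equal partition functions).
refuter-cdisprove-stmt-AtomisticToContinuum-10967-0.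
-/

noncomputable section

open MeasureTheory ProbabilityTheory Real
open scoped ENNReal InnerProductSpace

namespace Summit.AtomisticToContinuum.HydrodynamicLimit.Theorems
namespace KineticFluxLdDecayTilt

/-! ### A. Jensen for `exp` in `lintegral` form -/

section Jensen

variable {α : Type*} [MeasurableSpace α]

/-- Jensen for the exponential, lower-integral form: `exp(∫ f dμ) ≤ ∫⁻ exp(f) dμ` for an integrable
`f` on a probability space (if `exp ∘ f` is not integrable the right-hand side is `∞`). [folklore] -/
theorem ofReal_exp_integral_le_lintegral (μ : Measure α) [IsProbabilityMeasure μ] {f : α → ℝ}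
    (hf : Integrable f μ) :
    ENNReal.ofReal (Real.exp (∫ x, f x ∂μ)) ≤ ∫⁻ x, ENNReal.ofReal (Real.exp (f x)) ∂μ := by
  have hm : AEStronglyMeasurable (fun x => Real.exp (f x)) μ :=
    Real.continuous_exp.comp_aestronglyMeasurable hf.aestronglyMeasurable
  by_cases hi : Integrable (fun x => Real.exp (f x)) μ
  · have hJ : Real.exp (∫ x, f x ∂μ) ≤ ∫ x, Real.exp (f x) ∂μ :=
      (convexOn_exp).map_integral_le Real.continuous_exp.continuousOn isClosed_univ
        (by simp) hf hi
    rw [← ofReal_integral_eq_lintegral_ofReal hi (ae_of_all _ fun x => (Real.exp_pos _).le)]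
    exact ENNReal.ofReal_le_ofReal hJ
  · have htop : ∫⁻ x, ENNReal.ofReal (Real.exp (f x)) ∂μ = ∞ := by
      have h2 : ¬ HasFiniteIntegral (fun x => Real.exp (f x)) μ := fun h => hi ⟨hm, h⟩
      rw [hasFiniteIntegral_iff_enorm, not_lt, top_le_iff] at h2
      rw [← h2]
      refine lintegral_congr fun x => ?_
      rw [Real.enorm_eq_ofReal (Real.exp_pos _).le]
    rw [htop]
    exact le_top

/-- Density (Donsker–Varadhan type) form of Jensen: if `P = Q · e^{L}` with `Q` a probability measure,
then `exp(∫ (Y + L) dQ) ≤ ∫⁻ e^{Y} dP`. [folklore] -/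
theorem ofReal_exp_le_lintegral_withDensity (Q : Measure α) [IsProbabilityMeasure Q]
    {Y L : α → ℝ} (hY : Measurable Y) (hL : Measurable L) (hYi : Integrable Y Q)
    (hLi : Integrable L Q) :
    ENNReal.ofReal (Real.exp (∫ x, Y x ∂Q + ∫ x, L x ∂Q)) ≤
      ∫⁻ x, ENNReal.ofReal (Real.exp (Y x))
        ∂(Q.withDensity fun x => ENNReal.ofReal (Real.exp (L x))) := by
  rw [lintegral_withDensity_eq_lintegral_mul _ (hL.exp.ennreal_ofReal) (hY.exp.ennreal_ofReal),
    ← integral_add hYi hLi]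
  calc ENNReal.ofReal (Real.exp (∫ x, Y x + L x ∂Q))
      ≤ ∫⁻ x, ENNReal.ofReal (Real.exp (Y x + L x)) ∂Q :=
        ofReal_exp_integral_le_lintegral Q (hYi.add hLi)
    _ = _ := by
        refine lintegral_congr fun x => ?_
        simp only [Pi.mul_apply]
        rw [Real.exp_add, ENNReal.ofReal_mul (Real.exp_pos _).le, mul_comm]

end Jensen

/-! ### B. Gaussian facts on `ℝ³` -/

section Gauss

variable {E : Type*} [NormedAddCommGroup E] [InnerProductSpace ℝ E] [FiniteDimensional ℝ E]
  [MeasurableSpace E] [BorelSpace E]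

/-- `E cos⟪w, t⟫ = e^{-‖t‖²/2}` under the standard Gaussian (real part of the characteristic
function). [folklore] -/
theorem integral_cos_inner_stdGaussian (t : E) :
    ∫ w, Real.cos (⟪w, t⟫_ℝ) ∂stdGaussian E = Real.exp (-‖t‖ ^ 2 / 2) := by
  have h := charFun_stdGaussian (E := E) t
  rw [charFun_apply] at h
  have hint : Integrable (fun w : E => Complex.exp (⟪w, t⟫_ℝ * Complex.I)) (stdGaussian E) := by
    refine (integrable_const (1 : ℝ)).mono' (by fun_prop) (ae_of_all _ fun w => ?_)
    rw [Complex.norm_exp_ofReal_mul_I]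
  have hre : ∫ w, (Complex.exp (⟪w, t⟫_ℝ * Complex.I)).re ∂stdGaussian E =
      (∫ w, Complex.exp (⟪w, t⟫_ℝ * Complex.I) ∂stdGaussian E).re := by
    simpa using integral_re hint
  simp only [Complex.exp_ofReal_mul_I_re, h] at hre
  rw [hre]
  have : (-(‖t‖ : ℂ) ^ 2 / 2) = ((-‖t‖ ^ 2 / 2 : ℝ) : ℂ) := by push_cast; ring
  rw [this, Complex.exp_ofReal_re]

/-- `E sin⟪w, t⟫ = 0` under the standard Gaussian (imaginary part of the characteristic function).
[folklore] -/
theorem integral_sin_inner_stdGaussian (t : E) :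
    ∫ w, Real.sin (⟪w, t⟫_ℝ) ∂stdGaussian E = 0 := by
  have h := charFun_stdGaussian (E := E) t
  rw [charFun_apply] at h
  have hint : Integrable (fun w : E => Complex.exp (⟪w, t⟫_ℝ * Complex.I)) (stdGaussian E) := by
    refine (integrable_const (1 : ℝ)).mono' (by fun_prop) (ae_of_all _ fun w => ?_)
    rw [Complex.norm_exp_ofReal_mul_I]
  have him : ∫ w, (Complex.exp (⟪w, t⟫_ℝ * Complex.I)).im ∂stdGaussian E =
      (∫ w, Complex.exp (⟪w, t⟫_ℝ * Complex.I) ∂stdGaussian E).im := by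
    simpa using integral_im hint
  simp only [Complex.exp_ofReal_mul_I_im, h] at him
  rw [him]
  have : (-(‖t‖ : ℂ) ^ 2 / 2) = ((-‖t‖ ^ 2 / 2 : ℝ) : ℂ) := by push_cast; ring
  rw [this, Complex.exp_ofReal_im]

/-- The standard Gaussian is invariant under linear isometries: `∫ f (L w) = ∫ f w`. [folklore] -/
theorem integral_comp_linearIsometryEquiv_stdGaussian (L : E ≃ₗᵢ[ℝ] E) (f : E → ℝ) :
    ∫ w, f (L w) ∂stdGaussian E = ∫ w, f w ∂stdGaussian E := by
  have hmp : MeasurePreserving L (stdGaussian E) (stdGaussian E) :=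
    ⟨L.continuous.measurable, stdGaussian_map L⟩
  exact hmp.integral_comp L.toHomeomorph.measurableEmbedding f

/-- Odd integrands have zero Gaussian mean. [folklore] -/
theorem integral_eq_zero_of_odd_stdGaussian {f : E → ℝ} (hf : ∀ w, f (-w) = -f w) :
    ∫ w, f w ∂stdGaussian E = 0 := by
  have h := integral_comp_linearIsometryEquiv_stdGaussian (LinearIsometryEquiv.neg ℝ (E := E)) f
  simp only [LinearIsometryEquiv.coe_neg, hf, integral_neg] at h
  linarith

end Gauss

/-! ### C. Sums of one-body functions under product laws -/

section Pi

variable {V : Type*} [MeasurableSpace V]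

/-- `∫ ∑ᵢ f(vᵢ) d(μ^{⊗n}) = n ∫ f dμ` for a probability measure `μ` and integrable `f`. [folklore] -/
theorem integral_sum_eval_pi (μ : Measure V) [IsProbabilityMeasure μ] {f : V → ℝ}
    (hf : Integrable f μ) (n : ℕ) :
    ∫ v, ∑ i : Fin n, f (v i) ∂Measure.pi (fun _ : Fin n => μ) = n * ∫ x, f x ∂μ := by
  have hmp : ∀ i : Fin n, MeasurePreserving (fun v : Fin n → V => v i)
      (Measure.pi fun _ : Fin n => μ) μ := fun i => measurePreserving_eval (fun _ : Fin n => μ) i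
  have hterm : ∀ i : Fin n, ∫ v, f (v i) ∂Measure.pi (fun _ : Fin n => μ) = ∫ x, f x ∂μ := by
    intro i
    have h1 : AEStronglyMeasurable f (Measure.map (fun v : Fin n → V => v i)
        (Measure.pi fun _ : Fin n => μ)) := by
      rw [(hmp i).map_eq]; exact hf.aestronglyMeasurable
    calc ∫ v, f (v i) ∂Measure.pi (fun _ : Fin n => μ)
        = ∫ x, f x ∂(Measure.map (fun v : Fin n → V => v i) (Measure.pi fun _ : Fin n => μ)) :=
          (integral_map (measurable_pi_apply i).aemeasurable h1).symm
      _ = ∫ x, f x ∂μ := by rw [(hmp i).map_eq]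
  have hint : ∀ i : Fin n, Integrable (fun v : Fin n → V => f (v i)) (Measure.pi fun _ : Fin n => μ) :=
    fun i => ((hmp i).integrable_comp hf.aestronglyMeasurable).2 hf
  rw [integral_finsetSum _ fun i _ => hint i]
  simp [hterm]

end Pi


/-! ### D. Log-likelihood ratio of Maxwellians and the Gibbs tilt identity -/

section Gibbs

open Literature.Analysis.FluidPDE Literature.MathematicalPhysics.KineticTheory

/-- Logarithm of the unit-density local Maxwellian on `ℝ³`:
`log M_{1,u,θ}(v) = -(3/2) log(2πθ) - ‖v - u‖²/(2θ)`. [folklore] -/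
theorem log_localMaxwellian {θ : ℝ} (hθ : 0 < θ) (u v : V3) :
    Real.log (localMaxwellian 1 θ u v) = -(3 / 2) * Real.log (2 * Real.pi * θ) - ‖v - u‖ ^ 2 / (2 * θ) := by
  unfold localMaxwellian
  have h2 : (0 : ℝ) < 2 * Real.pi * θ := by positivity
  rw [one_mul, Real.log_mul (Real.rpow_pos_of_pos h2 _).ne' (Real.exp_pos _).ne', Real.log_exp,
    Real.log_rpow h2, finrank_euclideanSpace_fin]
  push_cast
  ring

/-- The per-particle log-likelihood ratio `log M_{1,0,1}(v) - log M_{1,u₁,θ₁}(v)` between the reference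
Maxwellian (`θ = 1`, `u = 0`) and the tilted one. [folklore] -/
def llr1 (θ₁ : ℝ) (u₁ : V3) (v : V3) : ℝ :=
  Real.log (localMaxwellian 1 1 (0 : V3) v) - Real.log (localMaxwellian 1 θ₁ u₁ v)

/-- Closed form: `llr1 θ₁ u₁ v = (3/2) log θ₁ - ‖v‖²/2 + ‖v - u₁‖²/(2θ₁)`. [folklore] -/
theorem llr1_eq {θ₁ : ℝ} (hθ₁ : 0 < θ₁) (u₁ v : V3) :
    llr1 θ₁ u₁ v = 3 / 2 * Real.log θ₁ - ‖v‖ ^ 2 / 2 + ‖v - u₁‖ ^ 2 / (2 * θ₁) := by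
  rw [llr1, log_localMaxwellian one_pos, log_localMaxwellian hθ₁, sub_zero, mul_one,
    Real.log_mul (by positivity) hθ₁.ne']
  ring

/-- `llr1` is continuous. [folklore] -/
theorem continuous_llr1 {θ₁ : ℝ} (hθ₁ : 0 < θ₁) (u₁ : V3) : Continuous (llr1 θ₁ u₁) := by
  have : llr1 θ₁ u₁ = fun v => 3 / 2 * Real.log θ₁ - ‖v‖ ^ 2 / 2 + ‖v - u₁‖ ^ 2 / (2 * θ₁) :=
    funext fun v => llr1_eq hθ₁ u₁ v
  rw [this]
  fun_prop

/-- The tilt identity for one Maxwellian factor: `M_{1,0,1} = M_{1,u₁,θ₁} · e^{llr1}`. [folklore] -/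
theorem localMaxwellian_ref_eq {θ₁ : ℝ} (hθ₁ : 0 < θ₁) (u₁ v : V3) :
    localMaxwellian 1 1 (0 : V3) v = localMaxwellian 1 θ₁ u₁ v * Real.exp (llr1 θ₁ u₁ v) := by
  rw [llr1, Real.exp_sub, Real.exp_log (localMaxwellian_pos one_pos one_pos _ _),
    Real.exp_log (localMaxwellian_pos one_pos hθ₁ _ _), mul_div_assoc', mul_comm,
    ← mul_div_assoc', div_self (localMaxwellian_pos one_pos hθ₁ _ _).ne', mul_one]

/-- The configuration-level log-likelihood ratio `L(z) = ∑ᵢ llr1(vᵢ)`. [folklore] -/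
def llrConfig (θ₁ : ℝ) (u₁ : V3) {n : ℕ} (z : Config n (Fin 3) T3) : ℝ :=
  ∑ i, llr1 θ₁ u₁ (z i).2

/-- `llrConfig` is measurable. [folklore] -/
theorem measurable_llrConfig {θ₁ : ℝ} (hθ₁ : 0 < θ₁) (u₁ : V3) (n : ℕ) :
    Measurable (llrConfig θ₁ u₁ : Config n (Fin 3) T3 → ℝ) := by
  unfold llrConfig
  refine Finset.measurable_sum _ fun i _ => ?_
  exact (continuous_llr1 hθ₁ u₁).measurable.comp (measurable_pi_apply i).snd

/-- **The Gibbs tilt identity**: the reference homogeneous Gibbs measure (activity `1`, drift `0`,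
temperature `1`) is the tilted one (drift `u₁`, temperature `θ₁`) times `e^{∑ᵢ llr1(vᵢ)}` — the
partition functions agree (both equal the configurational one) and the Maxwellian factors tilt one by
one. [folklore] -/
theorem localGibbsMeasure_ref_eq_withDensity (σ : ℝ) {θ₁ : ℝ} (hθ₁ : 0 < θ₁) (u₁ : V3) (N : ℕ) :
    localGibbsMeasure σ (fun _ => 1) (fun _ => 0) (fun _ => 1) N =
      (localGibbsMeasure σ (fun _ => 1) (fun _ => u₁) (fun _ => θ₁) N).withDensity
        (fun z => ENNReal.ofReal (Real.exp (llrConfig θ₁ u₁ z))) := by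
  have hmQ : Measurable fun z : Config (N + 1) (Fin 3) T3 => ENNReal.ofReal
      (canonicalDensity (Torus.geometry (Fin 3)) (hsDiameter σ N) (N + 1)
        (localGibbsProfile (fun _ => 1) (fun _ => u₁) (fun _ => θ₁)) z) :=
    (measurable_canonicalDensity _ _
      (measurable_localGibbsProfile continuous_const continuous_const continuous_const)).ennreal_ofReal
  have hmL : Measurable fun z : Config (N + 1) (Fin 3) T3 =>
      ENNReal.ofReal (Real.exp (llrConfig θ₁ u₁ z)) :=
    (measurable_llrConfig hθ₁ u₁ (N + 1)).exp.ennreal_ofReal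
  unfold localGibbsMeasure
  rw [← withDensity_mul _ hmQ hmL]
  congr 1
  funext z
  simp only [Pi.mul_apply]
  -- partition functions agree
  have hZ : canonicalPartition (Torus.geometry (Fin 3)) (hsDiameter σ N) (N + 1)
        (localGibbsProfile (fun _ => (1 : ℝ)) (fun _ => (0 : V3)) (fun _ => (1 : ℝ))) =
      canonicalPartition (Torus.geometry (Fin 3)) (hsDiameter σ N) (N + 1)
        (localGibbsProfile (fun _ => (1 : ℝ)) (fun _ => u₁) (fun _ => θ₁)) := by
    rw [canonicalPartition_eq_posPartition continuous_const continuous_const continuous_const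
        (fun _ => zero_le_one) (fun _ => one_pos),
      canonicalPartition_eq_posPartition continuous_const continuous_const continuous_const
        (fun _ => zero_le_one) (fun _ => hθ₁)]
  -- tensor powers tilt factor by factor
  have hT : tensorPow (N + 1) (localGibbsProfile (fun _ => (1 : ℝ)) (fun _ => (0 : V3)) (fun _ => (1 : ℝ))) z =
      tensorPow (N + 1) (localGibbsProfile (fun _ => (1 : ℝ)) (fun _ => u₁) (fun _ => θ₁)) z *
        Real.exp (llrConfig θ₁ u₁ z) := by
    simp only [tensorPow, localGibbsProfile, llrConfig, Real.exp_sum, ← Finset.prod_mul_distrib]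
    refine Finset.prod_congr rfl fun i _ => ?_
    rw [localMaxwellian_ref_eq hθ₁ u₁ (z i).2]
    ring
  have hnn : 0 ≤ canonicalDensity (Torus.geometry (Fin 3)) (hsDiameter σ N) (N + 1)
      (localGibbsProfile (fun _ => (1 : ℝ)) (fun _ => u₁) (fun _ => θ₁)) z := by
    unfold canonicalDensity
    refine mul_nonneg (inv_nonneg.2 (canonicalPartition_nonneg _ _ _
      (localGibbsProfile_nonneg (fun _ => zero_le_one) fun _ => hθ₁.le))) ?_
    exact Set.indicator_nonneg (fun w _ => tensorPow_nonneg
      (localGibbsProfile_nonneg (fun _ => zero_le_one) fun _ => hθ₁.le) _ w) z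
  rw [← ENNReal.ofReal_mul hnn]
  congr 1
  simp only [canonicalDensity, hZ, mul_assoc]
  congr 1
  by_cases hz : z ∈ hardSphereDomain (Torus.geometry (Fin 3)) (N + 1) (hsDiameter σ N)
  · rw [Set.indicator_of_mem hz, Set.indicator_of_mem hz, hT]
  · rw [Set.indicator_of_notMem hz, Set.indicator_of_notMem hz, zero_mul]

end Gibbs

end KineticFluxLdDecayTilt
end Summit.AtomisticToContinuum.HydrodynamicLimit.Theorems
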